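import Summits.QuantumFields.YangMills.Theorems.BalabanUVNodesN15KingModelMasslessOSReconstruction
import Summits.QuantumFields.YangMills.Theorems.BalabanUVNodesN15KingModelMasslessOSGaplessBound
import Summits.QuantumFields.YangMills.Theorems.BalabanUVNodesN15KingModelTransferOperatorMassGap

/-!
# BalabanUVNodes ∕ N15 — THE KING-MODEL RUNG (PART Ͳ-f₄): THE TRANSFER OPERATOR OF THE MASSLESS (CRITICAL) BLOCK FIELD IS GAPLESS — `‖T P_{Ω^⊥}‖ = 1`, `massGap = 0`, no `HasMassGap m`
# (Track A, DAG node N15 = NE2; FAN-OUT v1.1 §N15 s3 «KING-MODEL RUNG»; count-neutral)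

HONEST FRAMING.  Count-neutral (cell `pub-ymgap`, seat `pub-ymgap-dag-n15-e` g36; `--supports stmt-QuantumFields-27366 --as helper` = K3⁸).  King's `A = 0`, `g = 0` model
([King1986] C. King, Commun. Math. Phys. **102** (1986) 649–677): the MASSLESS infinite-volume block field `μ⁰_∞` (`d + 1 ≥ 3`) — the fixed point of the block-spin RG (parts Ϻ-cc∕dd) —
and its Osterwalder–Schrader transfer operator (part Ͳ-f₂).  The tree's spectral bound `|⟪v, T^t v⟫ − ⟪v,Ω⟫⟪Ω,v⟫| ≤ ‖v‖²·gapNorm^t` at `v = ι(e^{iφ(0)})` (`‖v‖² ≤ 1`) against part Ͳ-f₃'s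
POLYNOMIAL lower bound gives `e^{−S₂^{0}(0)}S₂^{0}(e₀+te₀) ≤ gapNorm^t` for all `t`; since that lower bound beats every `r^t`, `r < 1`: ★★★ **`king0_gapNorm_eq_one : gapNorm = 1`** —
THE TRANSFER OPERATOR OF THE CRITICAL BLOCK FIELD HAS NO MASS GAP: ★★★ **`king0_not_hasMassGap : ¬ HasMassGap m`** for every `m`, **`king0_massGap_eq_zero : massGap = 0`**.  Contrast: part Ͳ-e₂
(`massGap = √m²` for the massive field).  HONEST: free fields; by-name inhabitants of the tree's interfaces; NOT Bałaban's objects; NOT a node discharge; nothing about Yang–Mills ∕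
continuum ∕ `ℝ⁴` ∕ Clay.  0 `sorry`, 0 def; standard axioms.

WHAT THIS FILE PROVES (kernel).  `king0_norm_rpMap_onePoint_sq_le_one`, ★★ `king0_onePoint_lowerBound_le_gapNorm_pow`, ★★★ **`king0_gapNorm_eq_one`**, ★★★ **`king0_not_hasMassGap`**,
★★★ **`king0_massGap_eq_zero`**.

HONEST SCOPE.  King's free massless infinite-volume block field, `d + 1 ≥ 3`.  N15 untouched; counts unmoved.
Locators (use): [King1986] Thm 2.1 (2.22) p.654, (4.5) p.670; Glimm–Jaffe 1987 §6.1 Thm. 6.1.3, §19.7 Thm. 19.7.1.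
-/

noncomputable section

open scoped BigOperators Topology ComplexConjugate InnerProductSpace
open Filter MeasureTheory ProbabilityTheory Finset Complex

namespace Summit.QuantumFields.YangMills.BalabanUVNodes.N15KingModelRung.InfiniteVolume

open Literature.MathematicalPhysics.QuantumFieldTheory (latticeTimeReflection positiveTimeSites positiveTimeEvents latticeTimeShift)
open Literature.Probability.LatticeModels (configReflect IsBoundedMeasurable IsRPMeasureData IsOSRealisation TransferData rpMap rpTransferData rpMap_of_mem osMap
  norm_osMap_sq bddMeasurable)
open Summit.QuantumFields.YangMills.BalabanUVNodes.N15KingModelRung.OptimalDecay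
open Summit.QuantumFields.YangMills.BalabanUVNodes.N15KingModelRung.ProperTime

variable {d : ℕ}

/-- `‖ι(e^{iφ(0)})‖² ≤ 1` in the OS space of `μ⁰_∞` (OS seminorm ≤ `L²`). [cite: GlimmJaffe1987, §6.1 (6.1.12)] -/
theorem king0_norm_rpMap_onePoint_sq_le_one (hd : 2 ≤ d) :
    ‖rpMap (king0_isRPMeasureData (d := d) hd) (fun ω : (Fin (d + 1) → ℤ) → ℝ => Complex.exp (((ω 0 : ℝ) : ℂ) * I))‖ ^ 2 ≤ 1 := by
  haveI := isProbabilityMeasure_kingFieldInf0 hd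
  set h := king0_isRPMeasureData (d := d) hd with hh
  have hF := isBoundedMeasurable_onePoint (d := d)
  rw [rpMap_of_mem h hF, norm_osMap_sq, IsRPMeasureData.core_inner]
  have hFm : Measurable fun ω : (Fin (d + 1) → ℤ) → ℝ => Complex.exp (((ω 0 : ℝ) : ℂ) * I) := hF.1.mono cylinderEvents_le_pi le_rfl
  have hb : ∀ ω : (Fin (d + 1) → ℤ) → ℝ, ‖Complex.exp (((ω 0 : ℝ) : ℂ) * I)‖ ≤ 1 := fun ω => by rw [Complex.norm_exp_ofReal_mul_I]
  exact (re_integral_conj_mul_le_integral_normSq h.measurePreserving_reflect hFm hb).trans (integral_normSq_onePoint_cexp (d := d) hd).le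

/-- ★★ `e^{−S₂^{0}(0)}·S₂^{0}(e₀ + te₀) ≤ gapNorm^t` for all `t` (lower bound ≤ |truncated pairing| = |⟪v,T^tv⟫ − ⟪v,Ω⟫⟪Ω,v⟫| ≤ ‖v‖²gapNorm^t ≤ gapNorm^t).
[cite: GlimmJaffe1987, §6.1 Thm. 6.1.3, §19.7; King1986, Thm 2.1 (2.22) p.654] -/
theorem king0_onePoint_lowerBound_le_gapNorm_pow (hd : 2 ≤ d) (t : ℕ) :
    Real.exp (-kingS2Inf0 (0 : Fin (d + 1) → ℤ)) * kingS2Inf0 ((Pi.single 0 1 : Fin (d + 1) → ℤ) + (t : ℤ) • (Pi.single 0 (1 : ℤ) : Fin (d + 1) → ℤ))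
      ≤ (rpTransferData (king0_isRPMeasureData (d := d) hd) (king0_shift_nonneg hd)).gapNorm ^ t := by
  have hOS := king0_isOSRealisation (d := d) hd
  have hF := isBoundedMeasurable_onePoint (d := d)
  set v := rpMap (king0_isRPMeasureData (d := d) hd) (fun ω : (Fin (d + 1) → ℤ) → ℝ => Complex.exp (((ω 0 : ℝ) : ℂ) * I)) with hv
  set D := rpTransferData (king0_isRPMeasureData (d := d) hd) (king0_shift_nonneg hd) with hD
  have hid := os_truncated_onePoint0_eq (d := d) hd t
  rw [hOS.integral_conj_comp_reflect_mul_comp_iterate hF hF t, hOS.integral_conj_comp_reflect hF, hOS.integral_eq_inner_vacuum hF] at hid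
  have hspec := D.norm_inner_pow_apply_sub_le v v t
  have hlow := os_truncated_onePoint0_norm_ge d (kingS2Inf0 (d := d)) t
  rw [← hid] at hlow
  have hv1 : ‖v‖ * ‖v‖ ≤ 1 := by
    have h := king0_norm_rpMap_onePoint_sq_le_one (d := d) hd
    rw [← hv] at h
    nlinarith [norm_nonneg v]
  have hg0 : 0 ≤ D.gapNorm ^ t := pow_nonneg D.gapNorm_nonneg t
  calc _ ≤ _ := hlow
    _ ≤ ‖v‖ * ‖v‖ * D.gapNorm ^ t := hspec
    _ ≤ 1 * D.gapNorm ^ t := mul_le_mul_of_nonneg_right hv1 hg0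
    _ = D.gapNorm ^ t := one_mul _

/-- ★★★ **THE TRANSFER OPERATOR OF THE CRITICAL BLOCK FIELD IS GAPLESS**: `‖T P_{Ω^⊥}‖ = 1` (were it `< 1`, `gapNorm^t` would be beaten by part Ͳ-f₃'s polynomial lower bound).
[cite: King1986, Thm 2.1 (2.22) p.654, (4.5) p.670; GlimmJaffe1987, §19.7 Thm. 19.7.1] -/
theorem king0_gapNorm_eq_one (hd : 2 ≤ d) :
    (rpTransferData (king0_isRPMeasureData (d := d) hd) (king0_shift_nonneg hd)).gapNorm = 1 := by
  set D := rpTransferData (king0_isRPMeasureData (d := d) hd) (king0_shift_nonneg hd) with hD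
  refine le_antisymm D.gapNorm_le_one ?_
  by_contra hlt
  push Not at hlt
  obtain ⟨t, ht⟩ := exists_pow_lt_onePoint0_lowerBound (d := d) hd D.gapNorm_nonneg hlt
  exact absurd (king0_onePoint_lowerBound_le_gapNorm_pow (d := d) hd t) (not_le.mpr ht)

/-- ★★★ **NO MASS GAP AT THE CRITICAL POINT**: the transfer operator of `μ⁰_∞` has `HasMassGap m` for NO `m`. [cite: King1986, Thm 2.1 (2.22) p.654; GlimmJaffe1987, §6.1, §19.7] -/
theorem king0_not_hasMassGap (hd : 2 ≤ d) (m : ℝ) :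
    ¬ (rpTransferData (king0_isRPMeasureData (d := d) hd) (king0_shift_nonneg hd)).HasMassGap m := by
  rintro ⟨hm, hle⟩
  rw [king0_gapNorm_eq_one hd] at hle
  have : Real.exp (-m) < 1 := Real.exp_lt_one_iff.mpr (by linarith)
  linarith

/-- ★★★ **THE MASS GAP OF THE CRITICAL BLOCK FIELD IS ZERO** (the tree's `EReal`-valued `TransferData.massGap`). [cite: King1986, Thm 2.1 (2.22) p.654; GlimmJaffe1987, §6.1] -/
theorem king0_massGap_eq_zero (hd : 2 ≤ d) :
    (rpTransferData (king0_isRPMeasureData (d := d) hd) (king0_shift_nonneg hd)).massGap = 0 := by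
  rw [TransferData.massGap, king0_gapNorm_eq_one hd, if_neg one_ne_zero, Real.log_one, neg_zero]
  rfl

end Summit.QuantumFields.YangMills.BalabanUVNodes.N15KingModelRung.InfiniteVolume
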